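import Summits.Ventures.HodgeRepro.Tier3PinningGlue

/-!
# Tier 3, T3.2 — the ν ↔ ζ dictionary's kernel half: `ζ − 1` is an evaluation point for every
`p`-power root of unity `ζ` (seat t3-p3, gen 2)

Blind re-derivation cell `pub-hodge-repro`, Tier-3 seat `t3-p3` (route/TIER3.md v1.1 §3 row R-B, sub-residual
R-B.3 «the ν ↔ ζ dictionary», closed on paper by t3-p4 on Lang GTM 121).  The interpolation glue
(`Tier3Weierstrass.finite_vanishing_of_interpolation`, `Tier3PinningGlue.*`) takes as a HYPOTHESIS that the
point `ζ_ν − 1 ∈ B` attached to a finite-order character `ν` of `Γ_𝔭 ≅ ℤ_p` is topologically nilpotent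
(`PowerSeries.HasEval (ζ_ν − 1)`).  This file proves that hypothesis from what `ζ_ν` is — a `p`-power root of
unity — in any linearly topologised commutative ring `B` in which `p` itself is topologically nilpotent
(e.g. `O_{ℂ_p}` with its `p`-adic topology):

* `IsTopologicallyNilpotent.of_pow` — if some power `a^N` (`N > 0`) is topologically nilpotent, so is `a`
  (a linear topology has a basis of ideals, and `a^m = (a^N)^{m/N} · a^{m mod N}`);
* `sub_one_pow_prime_pow_eq_mul` — `(ζ − 1)^{p^n} = p · b` for some `b` whenever `ζ^{p^n} = 1`
  (Mathlib's `add_pow_prime_pow_eq'`: every middle binomial coefficient of `(ζ − 1)^{p^n}` is divisible by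
  `p`, and `ζ^{p^n} + (−1)^{p^n} ∈ {0, 2}`);
* `hasEval_sub_one_of_pow_prime_pow_eq_one` — the dictionary's kernel half: `PowerSeries.HasEval (ζ − 1)`;
* `four_line_pinning_of_rootsOfUnity` — `four_line_pinning_of_interpolation` with the evaluation-point
  hypothesis DISCHARGED: the characters enter only through their roots of unity `ζ ν` with
  `(ζ ν)^{p^{n ν}} = 1`.

HONESTY.  Nothing here is about Hecke characters or `L`-values: `hL` (the interpolation formula), `h0` (one
non-vanishing value per line — TIER3.md's residual R-B) and `hε` (sign cofiniteness) remain hypotheses.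
Nothing here says anything about the status of the Hodge conjecture for CM abelian varieties, which is NOT proved.
-/

set_option autoImplicit false

namespace Summit.Ventures.HodgeRepro.T3.R2Pinning

open Filter Topology

section Nilpotent

variable {B : Type*} [CommRing B] [TopologicalSpace B] [IsLinearTopology B B]

/-- If some positive power of `a` is topologically nilpotent, so is `a`. -/
theorem IsTopologicallyNilpotent.of_pow {a : B} {N : ℕ} (hN : 0 < N)
    (h : IsTopologicallyNilpotent (a ^ N)) : IsTopologicallyNilpotent a := by
  simp only [IsTopologicallyNilpotent, atTop_basis.tendsto_iff IsLinearTopology.hasBasis_ideal,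
    true_and] at h ⊢
  intro I hI
  obtain ⟨k₀, hk₀⟩ := h I hI
  refine ⟨N * k₀, fun m hm => ?_⟩
  have hq : k₀ ≤ m / N := (Nat.le_div_iff_mul_le hN).2 (by rw [mul_comm]; exact hm)
  have hm' : a ^ m = (a ^ N) ^ (m / N) * a ^ (m % N) := by
    rw [← pow_mul, ← pow_add, Nat.div_add_mod]
  rw [hm']
  exact I.mul_mem_right _ (hk₀ _ hq)

omit [TopologicalSpace B] [IsLinearTopology B B] in
/-- `(ζ − 1)^{p^n}` is a multiple of `p` whenever `ζ^{p^n} = 1`. -/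
theorem sub_one_pow_prime_pow_eq_mul {p : ℕ} (hp : p.Prime) {ζ : B} {n : ℕ}
    (hζ : ζ ^ p ^ n = 1) : ∃ b : B, (ζ - 1) ^ p ^ n = (p : B) * b := by
  have h := add_pow_prime_pow_eq' hp ζ (-1) n
  rw [← sub_eq_add_neg, hζ] at h
  set S := ∑ k ∈ Finset.Ioo 0 (p ^ n), ζ ^ k * (-1 : B) ^ (p ^ n - k) * ↑((p ^ n).choose k / p)
  rcases hp.eq_two_or_odd' with rfl | hodd
  · rcases neg_one_pow_eq_or B (2 ^ n) with h1 | h1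
    · refine ⟨1 + S, ?_⟩
      rw [h, h1]
      push_cast
      ring
    · refine ⟨S, ?_⟩
      rw [h, h1]
      ring
  · refine ⟨S, ?_⟩
    rw [h, (hodd.pow (n := n)).neg_one_pow]
    ring

/-- **The dictionary's kernel half.** In a linearly topologised commutative ring in which `p` is
topologically nilpotent, `ζ − 1` is topologically nilpotent — an evaluation point of power series
(`PowerSeries.HasEval`) — for every `p`-power root of unity `ζ`. -/
theorem hasEval_sub_one_of_pow_prime_pow_eq_one {p : ℕ} (hp : p.Prime)
    (hpB : IsTopologicallyNilpotent (p : B)) {ζ : B} {n : ℕ} (hζ : ζ ^ p ^ n = 1) :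
    PowerSeries.HasEval (ζ - 1) := by
  obtain ⟨b, hb⟩ := sub_one_pow_prime_pow_eq_mul hp hζ
  refine IsTopologicallyNilpotent.of_pow (pow_pos hp.pos n) ?_
  rw [hb]
  exact hpB.mul_right b

end Nilpotent

section Glue

open PowerSeries

variable {A : Type*} [CommRing A] [IsDomain A] [IsDiscreteValuationRing A]
  [IsAdicComplete (IsLocalRing.maximalIdeal A) A] [UniformSpace A] [IsUniformAddGroup A]
  [IsTopologicalRing A]
variable {B : Type*} [CommRing B] [IsDomain B] [UniformSpace B] [IsUniformAddGroup B] [T2Space B]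
  [CompleteSpace B] [IsTopologicalRing B] [IsLinearTopology B B] [Algebra A B] [ContinuousSMul A B]
variable {Ξ : Type*}

/-- **The face, with the evaluation points discharged.** As `four_line_pinning_of_interpolation`, but the
twists enter only through `p`-power roots of unity `ζ ν` (`(ζ ν)^{p^{n ν}} = 1`, `ν ↦ ζ ν` injective) in a ring
`B` where `p` is topologically nilpotent; the interpolation formula is stated at the points `ζ ν − 1`. -/
theorem four_line_pinning_of_rootsOfUnity [Infinite Ξ] [CommGroup Ξ]
    (hinj : Function.Injective (algebraMap A B)) {p : ℕ} (hp : p.Prime)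
    (hpB : IsTopologicallyNilpotent (p : B)) (ζ : Ξ → B) (hζ : Function.Injective ζ) (n : Ξ → ℕ)
    (hroot : ∀ ν, ζ ν ^ p ^ n ν = 1) (G : Fin 4 → PowerSeries A) (L u : Fin 4 → Ξ → B)
    (hu : ∀ j ν, u j ν ≠ 0)
    (hL : ∀ j ν, L j ν = u j ν * aeval (hasEval_sub_one_of_pow_prime_pow_eq_one hp hpB (hroot ν)) (G j))
    (h0 : ∀ j, ∃ ν₀, L j ν₀ ≠ 0) (ε : Fin 4 → Ξ → ℤˣ) (hε : ∀ j, {ν | ε j ν ≠ 1}.Finite) :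
    {ν : Ξ | ∀ j, L j ν ≠ 0 ∧ ε j ν = 1}.Infinite ∧
      ∀ ν ∈ {ν : Ξ | ∀ j, L j ν ≠ 0 ∧ ε j ν = 1}, ∀ η : Fin 4 → Ξ, (∀ j, η j = ν) →
        η 0 * η 1 = η 2 * η 3 :=
  four_line_pinning_of_interpolation (B := B) hinj ζ hζ
    (fun ν => hasEval_sub_one_of_pow_prime_pow_eq_one hp hpB (hroot ν)) G L u hu hL h0 ε hε

end Glue

end Summit.Ventures.HodgeRepro.T3.R2Pinning
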